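import Literature.Computability.Complexity.CHBitsFromResidues
import HarnessLib

/-!
# Iterated multiplication inside the counting hierarchy: the bits of a product (Bürgisser's Thm. 3.7)

Toolkit file (theorems only) of the scaled-up `FOM + MAJ` calculus. **Theorem**
(`iterProdBits_mem_CH`; Bürgisser, ECCC TR06-113, Thm. 3.7(1), the product `d(n) = ∏ₖ a(n, k)` for
nonnegative factors, in the bit-predicate form of Def. 3.1): if the bit predicate
`{⟨u, j⟩ | bit (val j) of G u}` of a family of numbers `G u < 2^{2^{r|u|}}` is in `CH`, then so is
the bit predicate of the iterated products `x ↦ ∏_{i < 2^{p|x|}} G ⟨x, bin i⟩`.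

Printed proof (p. 12): "By Theorem 3.4 we know `CR(a) ∈ CH` and it suffices to prove that
`CR(d) ∈ CH` … `d(n) mod p = g^{γ(n)}` is computable in `CH`." Here: the residues of the factors
are `CH`-definable (`CHModArith.modLongGraph_mem_CH`, HAB Lemma 4.1), hence so are the residues of
the products (`CHIterProd.iterProdModGraph_mem_CH`, HAB §4 Step 2), and Thm. 3.4
(`CHBitsFromResidues.bitsOfResidues_mem_CH`, HAB Thm. 4.1) converts them to bits.

## References

* P. Bürgisser, ECCC TR06-113 (2006), Thm. 3.7(1) and its proof, Thm. 3.4.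
* W. Hesse, E. Allender, D. A. M. Barrington, JCSS 65 (2002), §4.
-/

namespace Literature.Computability.Complexity

open _root_.Computability Polynomial PRelSigma TTClosure Brick PPSharpP ThresholdPP Plumb Finset

section IterProdBits

variable {G : List Bool → ℕ} (p r : Polynomial ℕ)

/-! ### Size of the products -/

/-- **Bit-size of the iterated product**: if `G u < 2^{2^{r|u|}}` then
`∏_{i < 2^{p|x|}} G ⟨x, bin i⟩ < 2^{2^{(r ∘ (2X+2+p) + p)(|x|)}}` (`2^{p|x|}` factors, each of
`2^{r(2|x|+2+p|x|)}` bits). [folklore] -/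
theorem iterProd_lt_two_pow_two_pow (hGb : ∀ u, G u < 2 ^ 2 ^ r.eval u.length) (x : List Bool) :
    ∏ i ∈ range (2 ^ p.eval x.length), G (boolPair x (encodeNat i)) < 2 ^ 2 ^ (r.comp (2 * X + 2 + p) + p).eval x.length := by
  set E := (r.comp (2 * X + 2 + p)).eval x.length with hE
  have hfac : ∀ i ∈ range (2 ^ p.eval x.length), G (boolPair x (encodeNat i)) ≤ 2 ^ 2 ^ E - 1 := by
    intro i hi
    have h1 := hGb (boolPair x (encodeNat i))
    have h2 : r.eval (boolPair x (encodeNat i)).length ≤ E := by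
      rw [hE, eval_comp]
      refine TM2Iter.eval_mono r ?_
      rw [length_boolPair]
      simp only [eval_add, eval_mul, eval_ofNat, eval_X]
      have := (Brick.length_encodeNat_le_iff i _).2 (mem_range.1 hi)
      omega
    have h3 : 2 ^ 2 ^ r.eval (boolPair x (encodeNat i)).length ≤ 2 ^ 2 ^ E :=
      Nat.pow_le_pow_right (by norm_num) (Nat.pow_le_pow_right (by norm_num) h2)
    omega
  refine (prod_le_pow_card _ _ _ hfac).trans_lt ?_
  rw [card_range, eval_add, pow_add, pow_mul]
  exact Nat.pow_lt_pow_left (Nat.sub_lt (Nat.two_pow_pos _) Nat.one_pos) (Nat.two_pow_pos _).ne'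

/-! ### Residues of the factors and of the products -/

/-- The residue function of the factors (from `CHModArith`), as a function of `w = ⟨u, m⟩`:
below the modulus (or `0`), hence `< 2^{|w|}`. [folklore] -/
theorem factorRes_lt_two_pow (w : List Bool) :
    (∑ j ∈ range (2 ^ r.eval (fstP w).length),
        (if (G (fstP w)).testBit j = true then (if bitsToNat (sndP w) ≤ 1 then 0 else 2 ^ j % bitsToNat (sndP w)) else 0)) %
        bitsToNat (sndP w) < 2 ^ (X : Polynomial ℕ).eval w.length := by
  have hm : bitsToNat (sndP w) < 2 ^ (X : Polynomial ℕ).eval w.length := by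
    rw [eval_X]
    refine (bitsToNat_lt _).trans_le (Nat.pow_le_pow_right (by norm_num) ?_)
    have a := length_fstF_sndF_le w
    change 2 * (fstP w).length + (sndP w).length ≤ _ at a
    omega
  by_cases h1 : bitsToNat (sndP w) ≤ 1
  · have h0 : (∑ j ∈ range (2 ^ r.eval (fstP w).length),
        (if (G (fstP w)).testBit j = true then (if bitsToNat (sndP w) ≤ 1 then 0 else 2 ^ j % bitsToNat (sndP w)) else 0)) = 0 :=
      sum_eq_zero fun j _ => by rw [if_pos h1]; split_ifs <;> rfl
    rw [h0, Nat.zero_mod]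
    exact Nat.two_pow_pos _
  · exact (Nat.mod_lt _ (by omega)).trans hm

/-- **The residues of the iterated products are `CH`-definable** (Bürgisser 2006, proof of
Thm. 3.7(1): "`d(n) mod p = g^{γ(n)}` is computable in `CH`"): there is a function `ρ` on `⟨x, μ⟩`
with a `CH` graph, below `2^{|·|}`, equal to `(∏_{i < 2^{p|x|}} G ⟨x, bin i⟩) mod val μ` for prime
`val μ` — the iterated-product rule applied to the residues of the (long) factors, cut off at
`i < 2^{p|x|}`. [cite: Burgisser2006, Theorem 3.7] -/
theorem exists_iterProdRes (hG : {z | (G (fstP z)).testBit (bitsToNat (sndP z)) = true} ∈ CH)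
    (hGb : ∀ u, G u < 2 ^ 2 ^ r.eval u.length) :
    ∃ ρ : List Bool → ℕ, {z | ρ (fstP z) = bitsToNat (sndP z)} ∈ CH ∧ (∀ u, ρ u < 2 ^ (X : Polynomial ℕ).eval u.length) ∧
      ∀ (x μ : List Bool), (bitsToNat μ).Prime →
        ρ (boolPair x μ) = (∏ i ∈ range (2 ^ p.eval x.length), G (boolPair x (encodeNat i))) % bitsToNat μ := by
  -- the residues of the factors, read on `w'' = ⟨⟨x, μ⟩, bin k⟩` through the recoding `⟨⟨x, bin k⟩, μ⟩`
  set Res : List Bool → ℕ := fun w =>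
    (∑ j ∈ range (2 ^ r.eval (fstP w).length),
        (if (G (fstP w)).testBit j = true then (if bitsToNat (sndP w) ≤ 1 then 0 else 2 ^ j % bitsToNat (sndP w)) else 0)) %
        bitsToNat (sndP w) with hRes
  have hResG : {z | Res (fstP z) = bitsToNat (sndP z)} ∈ CH := modLongGraph_mem_CH r hG
  have hrec : pairFn (pairFn (fstP ∘ fstP) sndP) (sndP ∘ fstP) ∈ FP :=
    pairFn_mem_FP (pairFn_mem_FP (comp_mem_FP fstP_mem_FP fstP_mem_FP) sndP_mem_FP) (comp_mem_FP sndP_mem_FP fstP_mem_FP)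
  obtain ⟨s, hs⟩ := exists_poly_length_le_of_mem_FP hrec
  have hA := graph_comp_FP_mem_CH hResG hrec
  have hAb := bound_comp_FP (factorRes_lt_two_pow (G := G) r) hs
  -- the cut-off `|bin k| ≤ p|x|`, a `P` test on `⟨⟨x, μ⟩, bin k⟩`
  have hCut : ({w | (sndP w).length ≤ p.eval (fstP (fstP w)).length} : Language Bool) ∈ CH :=
    P_subset_CH (mem_P_of_iff (preimage_mem_P (LenLe_mem_P p) (pairFn_mem_FP (comp_mem_FP fstP_mem_FP fstP_mem_FP) sndP_mem_FP))
      _ fun w => by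
        change _ ↔ pairFn (fstP ∘ fstP) sndP w ∈ LenLe p
        rw [pairFn_apply, boolPair_mem_LenLe]; rfl)
  have hA' : {z | (fun w => Res (pairFn (pairFn (fstP ∘ fstP) sndP) (sndP ∘ fstP) w)) (fstP z) = bitsToNat (sndP z)} ∈ CH := hA
  have ha := iteGraph_mem_CH' hCut (f := fun w => Res (pairFn (pairFn (fstP ∘ fstP) sndP) (sndP ∘ fstP) w)) (g := fun _ => 1)
    hA' (constGraph_mem_CH 1)
  have hab : ∀ w, (if (sndP w).length ≤ p.eval (fstP (fstP w)).length then Res (pairFn (pairFn (fstP ∘ fstP) sndP) (sndP ∘ fstP) w) else 1) <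
      2 ^ ((X : Polynomial ℕ).comp s + 1).eval w.length := fun w => by
    rw [eval_add, eval_one, pow_succ]
    have h1 : Res (pairFn (pairFn (fstP ∘ fstP) sndP) (sndP ∘ fstP) w) < 2 ^ ((X : Polynomial ℕ).comp s).eval w.length := hAb w
    have h2 : 1 ≤ 2 ^ ((X : Polynomial ℕ).comp s).eval w.length := Nat.one_le_two_pow
    split_ifs <;> omega
  -- the iterated product of the cut-off residues, read at `⟨⟨x, μ⟩, μ⟩`
  have hP := iterProdModGraph_mem_CH p
    (a := fun w => if (sndP w).length ≤ p.eval (fstP (fstP w)).length then Res (pairFn (pairFn (fstP ∘ fstP) sndP) (sndP ∘ fstP) w) else 1)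
    ha hab
  have hdup : pairFn id sndP ∈ FP := pairFn_mem_FP OracleCompose.id_mem_FP sndP_mem_FP
  refine ⟨fun u => (fun wt => if (bitsToNat (sndP wt)).Prime then
      (∏ k ∈ range (2 ^ p.eval (fstP wt).length),
        (fun w => if (sndP w).length ≤ p.eval (fstP (fstP w)).length then Res (pairFn (pairFn (fstP ∘ fstP) sndP) (sndP ∘ fstP) w) else 1)
          (boolPair (fstP wt) (encodeNat k))) % bitsToNat (sndP wt) else 0) (pairFn id sndP u),
    graph_comp_FP_mem_CH hP hdup, fun u => ?_, fun x μ hμ => ?_⟩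
  · -- bit-size: below the modulus `val (sndP u)` or `0`
    simp only [pairFn_apply, sndP_boolPair, id]
    split_ifs with h
    · rw [eval_X]
      refine (Nat.mod_lt _ h.pos).trans ((bitsToNat_lt _).trans_le (Nat.pow_le_pow_right (by norm_num) ?_))
      have a := length_fstF_sndF_le u
      change 2 * (fstP u).length + (sndP u).length ≤ _ at a
      omega
    · exact Nat.two_pow_pos _
  · -- semantics: cut the range down to `2^{p|x|}` and unreduce the factors modulo the prime `val μ`
    simp only [pairFn_apply, Function.comp_apply, fstP_boolPair, sndP_boolPair, id, Brick.length_encodeNat_le_iff]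
    rw [if_pos hμ, ← prod_filter]
    have hrange : (range (2 ^ p.eval (boolPair x μ).length)).filter (fun k => k < 2 ^ p.eval x.length) = range (2 ^ p.eval x.length) := by
      ext k
      simp only [mem_filter, mem_range]
      have : 2 ^ p.eval x.length ≤ 2 ^ p.eval (boolPair x μ).length :=
        Nat.pow_le_pow_right (by norm_num) (TM2Iter.eval_mono p (by rw [length_boolPair]; omega))
      omega
    rw [hrange, prod_nat_mod, prod_congr rfl fun k _ => ?_, ← prod_nat_mod]
    have hh := bitPowModSum_mod_eq r hGb (boolPair (boolPair x (encodeNat k)) μ) (by rw [sndP_boolPair]; exact hμ.two_le)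
    simp only [fstP_boolPair, sndP_boolPair] at hh
    rw [hRes]
    simp only [fstP_boolPair, sndP_boolPair]
    rw [hh, Nat.mod_mod]

/-! ### The theorem -/

/-- **Bürgisser's Theorem 3.7(1), iterated multiplication in `CH` (bit-predicate form)**: if the
bit predicate of a family `G ⟨x, bin i⟩` of numbers below `2^{2^{r|·|}}` is in `CH`, then so is the
bit predicate `{⟨x, s⟩ | bit (val s) of ∏_{i < 2^{p|x|}} G ⟨x, bin i⟩}` of its iterated products
("The claim for the iterated multiplication will follow by scaling up the arguments in Hesse et
al. [14] to the counting hierarchy", ECCC TR06-113, p. 12: residues by discrete logarithms, then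
Thm. 3.4). [cite: Burgisser2006, Theorem 3.7] -/
theorem iterProdBits_mem_CH (hG : {z | (G (fstP z)).testBit (bitsToNat (sndP z)) = true} ∈ CH)
    (hGb : ∀ u, G u < 2 ^ 2 ^ r.eval u.length) :
    {z | (∏ i ∈ range (2 ^ p.eval (fstP z).length), G (boolPair (fstP z) (encodeNat i))).testBit (bitsToNat (sndP z)) = true} ∈ CH := by
  obtain ⟨ρ, hρ, hρb, hρX⟩ := exists_iterProdRes p r hG hGb
  exact bitsOfResidues_mem_CH (r.comp (2 * X + 2 + p) + p)
    (Xf := fun x => ∏ i ∈ range (2 ^ p.eval x.length), G (boolPair x (encodeNat i)))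
    (iterProd_lt_two_pow_two_pow p r hGb) hρ hρb hρX

end IterProdBits

end Literature.Computability.Complexity
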